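/-
Copyright (c) 2026 the pub-hodgecm-mathlib formalisation cell (harness21).  R90-TF SLAB, section S10 (Rogawski 1990, Ch. 13.8), prover R90-C138-p01 (g0):
DEAL #44 (dealer R90-C138-plan (g3), 2026-09-05T02:19:49Z ∕ rulings 02:27:49Z on CENSUS 0075626e86ceb808) — the PAYER SKELETON of the A2a₂ socket
`sock_S10_realiseH₂ : RealiseH₂Letter R90.S2.CuspG₀ R90.S2.CuspH₀`, hypothesis-first over the TELESCOPE of letters E → T2 → A → B → C → D → F;
h413 = `stmt-HodgeConjecture-24833`, route `HCCMUnconditional`.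
-/
import Summits.HodgeConjecture.HodgeConjecture.Theorems.R90S10FrozenDatumTwoPlaceDefs               -- ★ p862969: `S10HDatum₂` over ★ C2 `S10HDatum` (91 fields), carriers, kit defs
import Summits.HodgeConjecture.HodgeConjecture.Theorems.R90S10ArchSignKitCuspOfArchBlockPacketCusp  -- ★ p864543 (p05, H-E4-1): `archSignKitCusp_of_archBlockPacketCusp` (kit from T2) + ★ `R90.S2.CuspG₀∕CuspH₀`
import Summits.HodgeConjecture.HodgeConjecture.Theorems.R90S10FrozenVectorKit                      -- ★ (p03 kit): `exists_sliceNormalised_haar` (R5-measure, Tate normalisation)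
import Summits.HodgeConjecture.HodgeConjecture.Theorems.F0P3SpectralPacketUnitarizableByOccurrence   -- ★ `IrrClass.IsSquareIntegrable`
import Literature.NumberTheory.Rogawski1990.U3PrincipalSeriesReducibility                            -- ★ `torusLocalComponent`, `localDet`
import Literature.NumberTheory.Automorphic.IrreducibleClassesBoxChar                                  -- ★ `IrrClass.boxChar`
import Literature.NumberTheory.Automorphic.UnramifiedOrbitalUnitFactorPair                            -- ★ `isCompact_isOpen_prod_cmLocalIntegralLevel`
import HarnessLib

/-!
# R90-TF ∕ S10 — THE A2a₂ PAYER SKELETON `realiseH₂_of_letters` (DEAL #44): the body of `RealiseH₂Letter R90.S2.CuspG₀ R90.S2.CuspH₀` FROM THE TELESCOPE OF LETTERS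

Cell hodgecm-mathlib, slab R90-TF, section S10 = [Rogawski1990] §13.8 Prop. 13.8.3 (proof, p. 218 L9–L28, p. 219 L1–L3), crux item h413 = `stmt-HodgeConjecture-24833`;
kernel lane `--kind proof --supports stmt-HodgeConjecture-24833 --as helper`; ONE THEOREM (no `def`, no instance, no notation, no `sorry`); never imports `Cruxes/…/Lines`
(LAW L9 — so the socket's body `RealiseH₂Letter` (Lines A :898–:919 @ED. 8) and S2's (T2) `stub_R90_S2_archBlockPacketCusp` (Lines D :91–:126) enter BY VALUE).

WHAT.  The A2a₂ socket `sock_S10_realiseH₂` asks, under ⟪P⟫ ⟪U⟫ `h3` and the (13.8.3) frame at `v`, for a global `H`-datum `𝔥 : S10HDatum₂ …` (★ C2's 91-field `S10HDatum` +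
`h3 ι₁ ι₂ hι harch₂`) realising a prescribed square-integrable `ρ₀` at `v` with prescribed control embeddings `ι₁ ≠ ι₂`.  The fields are DEPENDENT (`hpacki` reads
`dρ νH σH νfH KH K₂ χi ν₁i ν₁v χv`, `hθi` reads `K₁ d₁ χi ν₁i`, `hpin` reads `ρ v`, …), so the residual inputs form a TELESCOPE (dealer RULING on CENSUS 0075626e86ceb808,
02:27:49Z): each letter is universally quantified over the data of the earlier blocks and existential only in its own block —
* (E) `hE` — the ARCHIMEDEAN FRAME: Haar measures, torus measures and orbital families on `G_∞`, `H_∞` in Weil form with stable-conjugacy transport, Langlands–Shelstad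
  compatible, `Δ″_∞` non-degenerate with transfer — EXACTLY the premises of S2's (T2) [§4.3 (4.3.1) p. 43; §1.7];
* (T2) `hT2` — S2's archimedean block packet letter BY VALUE (★ p864543's binder bytes), read through ★ `archSignKitCusp_of_archBlockPacketCusp` into an ★ `ArchSignKit` `𝔞`
  whose frozen difference `f k₁ − f k₂` is cuspidal at every archimedean place, stably null, with a smooth cuspidal `Δ″_∞`-transfer `f^H_∞` and `Θ_{ρ_∞}(f^H_∞) = 2`
  [p. 218 L15–L28; Prop. 12.3.2];
* (A) `hA` — GLOBALISATION of `ρ₀` [p. 218 L9 citing Langlands L₁ p. 227]: a discrete automorphic `ρ₂` of `U(Φ₂)` with `ρ_{2,v} = ρ₀`, admissible local classes,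
  unramified off `v`, and archimedean type tied to the kit's `ρ_∞` through the ABSTRACT token `AT` (a parameter, like `CuspG`; S10 does not fix its mathematics here);
* (B) `hB` — the `H`-SIDE CUT: the full `t(ρ)`-fibre of `ρ₂` is finite, injective, contains the primitive witness, multiplicity one, exhaustive [Prop. 11.2.1 (a) p. 161;
  Thm. 11.5.1 (c) p. 165; §13.3];
* (C) `hC` — the `θ`-LINE on `U(Φ₁)`: an automorphic character `θ = (⟦ℂ_{χθ_w}⟧)_w` PINNED AT `v` to `ψ_v ∘ det` (the label of `πSt`), UNRAMIFIED OFF `v`, with its global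
  class `d₁` (multiplicity one) and its archimedean component `θ_∞ = χi dν₁i` pinned by the Flath split on `U(1)` [p. 218 L9–L10, p. 219 L1–L2] (★ p864606 `thetaLine_of_oneDim`
  pays it when `ξ.ψ` is unramified off `v`);
* (D) `hD` — FLATH ON `H` at the standard levels: `ρ = ρ₂ ⊠ θ = ⊗'_w ρ_w`, spherical lines off `v`, admissible factors, factor links, `Tr πSt = Tr ρ_v` [Flath Thm. 3–4; §4.9];
  the Tate-normalised finite-adelic Haar on `H` is ★ `exists_sliceNormalised_haar` (in-file, no letter);
* (F) `hF` — the LINK LAW `hpacki` (global–archimedean Flath split over the packet cut), universally quantified over everything above [p. 218 L22–L26, p. 219 L1–L3].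
The proof is the assembly: E → kit → A → B → C → D → Haar → F, then the 96-field structure literal (`KH K₂ K₁` := the standard levels at EVERY place, so `hKH hK₂std hK₁std`
are `rfl`; `harch` = the first six conjuncts of `harch₂`; `EH ρi hui hsci` := the kit's `ρ_∞`).  The residual letters' BODIES (the binder types of `hE hA hB hC hD hF`) are the
single source from which typ4 (g2) types `Theorems/R90S10RealiseH2ResidualLettersDefs.lean` (dealer 02:27:49Z Q1); A's edition pays `sock_S10_realiseH₂` by
`exact realiseH₂_of_letters AT hE stub_R90_S2_archBlockPacketCusp hA hB hC hD hF` after unfolding `RealiseH₂Letter`.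

HONEST LABEL: a hypothesis-first skeleton pays NOTHING by itself — it reduces A2a₂ to the letters E (S2∕S4 arch desk), A (EXT-class, Langlands L₁), B (E1-class), C (in house
modulo `ξ.ψ` unramified off `v`, else a `U(1)`-globalisation brick), D (in house, p06 #43), F (XL) and S2's (T2); HC_CM is proved only modulo the 7 printed citations
(2 remaining named inputs: hLiu418 = `stmt-HodgeConjecture-24832`, h413 = `stmt-HodgeConjecture-24833`) until rung 0 closes; REL ≠ ★ ≠ WRITTEN ≠ BUILT.

## References
* [Rogawski1990] J. Rogawski, *Automorphic Representations of Unitary Groups in Three Variables*, Ann. of Math. Stud. 123 (1990), §13.8 Prop. 13.8.3 (proof) p. 218 L9–L28,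
  p. 219 L1–L3; §11.2 Prop. 11.2.1 (a) p. 161; Thm. 11.5.1 (c) p. 165; §12.3 Prop. 12.3.2 p. 178; §4.3 (4.3.1) p. 43; §4.9 Prop. 4.9.1 p. 55; §14.6 p. 244.
* [Langlands1979L1] R. P. Langlands, *Les débuts d'une formule des traces stable*, Publ. Math. Univ. Paris VII 13 (1983), p. 227 (the globalisation cited p. 218 L9).
* [FlathCorvallis1979] D. Flath, *Decomposition of representations into tensor products*, Proc. Sympos. Pure Math. 33.1 (1979), Thm. 3–4.
* [Arthur1988InvariantTraceFormulaII] J. Arthur, *The invariant trace formula II*, J. Amer. Math. Soc. 1 (1988), Thm. 7.1 p. 538.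
-/

set_option autoImplicit false
set_option linter.dupNamespace false

noncomputable section

open scoped RestrictedProduct Matrix MatrixGroups InnerProductSpace
open Filter MeasureTheory NumberField IsDedekindDomain CompactlySupported
open Literature.NumberTheory.Rogawski1990 Literature.NumberTheory.Automorphic Literature.NumberTheory.Automorphic.UnitaryGroup
open Literature.NumberTheory.Automorphic.UnitaryGroup.CotangentForms Literature.NumberTheory.GaloisRepresentations
open Literature.NumberTheory.Automorphic.Arthur2013.Leaves.TECR
open Summit.HodgeConjecture.HodgeConjecture.Cruxes.H413.F0P3GlobalPacketDiscrete (cmOccursInDiscreteSpectrum)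
open Summit.HodgeConjecture.HodgeConjecture.Cruxes.H413.K2E1TraceFormulaBeta
open Summit.HodgeConjecture.HodgeConjecture.Cruxes.H413.K2E1SpectralTermsDiscreteHalf
open Summit.HodgeConjecture.HodgeConjecture.Cruxes.H413.K2E1bGKCohomologyU21.U8 (HasArchOpTrace)
open Summit.HodgeConjecture.HodgeConjecture.R90.S2 (CuspG₀ CuspH₀)

namespace Summit.HodgeConjecture.HodgeConjecture.R90.S10

set_option maxHeartbeats 400000 in
/-- **THE A2a₂ PAYER SKELETON — `realiseH₂_of_letters`**: the body of the socket `RealiseH₂Letter R90.S2.CuspG₀ R90.S2.CuspH₀` (a global `H`-datum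
`𝔥 : S10HDatum₂ …` realising `ρ₀` at `v` with control embeddings `ι₁ ≠ ι₂` and `ArchRegular` θ-data) FROM the telescope of letters `hE` (archimedean frame = T2's premises)
→ `hT2` (S2's block packet letter, by value) → `hA` (globalisation of `ρ₀`, archimedean type through the abstract token `AT`) → `hB` (`H`-side cut) → `hC` (θ-line pinned
at `v`, unramified off `v`, with `θ_∞`) → `hD` (Flath on `H` at the standard levels) → `hF` (the link law `hpacki`); the finite-adelic Haar is ★ `exists_sliceNormalised_haar`
and the kit is ★ `archSignKitCusp_of_archBlockPacketCusp hT2`.  Proof = `obtain` along the telescope and the 96-field structure literal.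
[cite: Rogawski1990, §13.8 Prop. 13.8.3 (proof) p. 218 L9–L28, p. 219 L1–L3; §11.2 Prop. 11.2.1 (a) p. 161; Thm. 11.5.1 (c) p. 165; §12.3 Prop. 12.3.2 p. 178]
[cite: FlathCorvallis1979, Thm. 3–4] [cite: Arthur1988InvariantTraceFormulaII, Thm. 7.1 p. 538] -/
theorem realiseH₂_of_letters
    (AT : ∀ (L : Type) [Field L] [NumberField L] [IsCMField L] [MeasurableSpace (H2 L).Adelic] [BorelSpace (H2 L).Adelic]
      (μH : Measure (H2 L).automorphicQuotient) [(H2 L).IsAutomorphicMeasure μH], DiscreteAutomorphicRep (H2 L) μH →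
      ∀ (EH : Type) [NormedAddCommGroup EH] [InnerProductSpace ℂ EH] [CompleteSpace EH], ContRepresentation ℂ (HArch L) EH → Prop)
    (hE : ∀ (L : Type) [Field L] [NumberField L] [IsCMField L] (μ : HeckeCharacter L)
      [MeasurableSpace (GArch L)] [BorelSpace (GArch L)] [MeasurableSpace (HArch L)] [BorelSpace (HArch L)],
      μ.IsUnitary →
      (∀ x : Literature.NumberTheory.GaloisRepresentations.ideleGroup ↥(maximalRealSubfield L),
        μ (AdeleRing.ideleBaseChange (↥(maximalRealSubfield L)) L x) = quadraticHeckeCharCM L x) →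
      ∃ (νGi : Measure (GArch L)) (_ : νGi.IsHaarMeasure) (_ : νGi.IsMulRightInvariant) (νHi : Measure (HArch L)) (_ : νHi.IsHaarMeasure) (_ : νHi.IsMulRightInvariant) (tGi : ∀ γ : GArch L, Measure (Subgroup.centralizer ({γ} : Set (GArch L)))) (tHi : ∀ a : HArch L, Measure (Subgroup.centralizer ({a} : Set (HArch L)))) (mGi : ArchOrbFamG L) (mHi : ArchOrbFamH L),
        (letI : ∀ γ : GArch L, MeasurableSpace (GArch L ⧸ Subgroup.centralizer ({γ} : Set (GArch L))) := fun _ => borel _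
    haveI : ∀ γ : GArch L, BorelSpace (GArch L ⧸ Subgroup.centralizer ({γ} : Set (GArch L))) := fun _ => ⟨rfl⟩
    mGi.IsQuotientOf (fun γ => IsRegularElt (γ.val : GL (Fin 3) (mixedEmbedding.mixedSpace L))) νGi tGi) ∧
        (∀ (γ₁ γ₂ : GArch L)
            (h₁ : IsRegularElt (γ₁.val : GL (Fin 3) (mixedEmbedding.mixedSpace L)))
            (hc : Corresponds (UnitaryGroup.conjMixed (↥(maximalRealSubfield L)) L (IsCMField.complexConj L))
              (UnitaryGroup.archFormOf L 3 (phi3 L)) (UnitaryGroup.archFormOf L 3 (phi3 L)) γ₁ γ₂),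
            Measure.map ⇑(UnitaryGroup.archStableCentralizerEquiv L (UnitaryGroup.isUnit_antidiagOne_det L 3).ne_zero
              (UnitaryGroup.isUnit_antidiagOne_det L 3).ne_zero hc h₁) (tGi γ₁) = tGi γ₂) ∧
        ArchCompatibleFamiliesH L νHi mHi tHi tGi ∧
        IsArchNondegenerate L (phi3 L) (archDeltaPP L μ) ∧
        IsArchDeltaTransferExists L (phi3 L) (archDeltaPP L μ) mHi mGi (ArchSmooth L 3 (phi3 L)) (ArchSmooth₂ L))
    (hT2 :
      ∀ (L : Type) [Field L] [NumberField L] [IsCMField L] (μ : HeckeCharacter L)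
        [MeasurableSpace (GInf L)] [BorelSpace (GInf L)] (ν : Measure (GInf L)) [ν.IsHaarMeasure] [ν.IsMulRightInvariant]
        [MeasurableSpace (HInf L)] [BorelSpace (HInf L)] (νH : Measure (HInf L)) [νH.IsHaarMeasure] [νH.IsMulRightInvariant],
      letI : ∀ a : HInf L, MeasurableSpace (HInf L ⧸ Subgroup.centralizer ({a} : Set (HInf L))) := fun _ => borel _
      haveI : ∀ a : HInf L, BorelSpace (HInf L ⧸ Subgroup.centralizer ({a} : Set (HInf L))) := fun _ => ⟨rfl⟩
      letI : ∀ γ : GInf L, MeasurableSpace (GInf L ⧸ Subgroup.centralizer ({γ} : Set (GInf L))) := fun _ => borel _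
      haveI : ∀ γ : GInf L, BorelSpace (GInf L ⧸ Subgroup.centralizer ({γ} : Set (GInf L))) := fun _ => ⟨rfl⟩
      ∀ (mH : OrbitalMeasureFamily (HInf L)) (mG : OrbitalMeasureFamily (GInf L))
        (tH : ∀ a : HInf L, Measure (Subgroup.centralizer ({a} : Set (HInf L))))
        (t : ∀ γ : GInf L, Measure (Subgroup.centralizer ({γ} : Set (GInf L)))),
        mG.IsQuotientOf (fun γ => IsRegularElt (γ.val : GL (Fin 3) (mixedEmbedding.mixedSpace L))) ν t →
        (∀ (γ₁ γ₂ : GInf L)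
            (h₁ : IsRegularElt (γ₁.val : GL (Fin 3) (mixedEmbedding.mixedSpace L)))
            (hc : Corresponds (UnitaryGroup.conjMixed (↥(maximalRealSubfield L)) L (IsCMField.complexConj L))
              (UnitaryGroup.archFormOf L 3 (phi3 L)) (UnitaryGroup.archFormOf L 3 (phi3 L)) γ₁ γ₂),
            Measure.map ⇑(UnitaryGroup.archStableCentralizerEquiv L (UnitaryGroup.isUnit_antidiagOne_det L 3).ne_zero
              (UnitaryGroup.isUnit_antidiagOne_det L 3).ne_zero hc h₁) (t γ₁) = t γ₂) →
        ArchCompatibleFamiliesH L νH mH tH t →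
        IsArchNondegenerate L (phi3 L) (archDeltaPP L μ) →
        IsArchDeltaTransferExists L (phi3 L) (archDeltaPP L μ) mH mG (ArchSmooth L 3 (phi3 L)) (ArchSmooth₂ L) →
          ∃ (κ : Type) (_ : Fintype κ) (_ : DecidableEq κ)
            (EG : κ → Type) (_ : ∀ k, NormedAddCommGroup (EG k)) (_ : ∀ k, InnerProductSpace ℂ (EG k)) (_ : ∀ k, CompleteSpace (EG k))
            (ϖ : ∀ k, ContRepresentation ℂ (GInf L) (EG k)) (hu : ∀ k, (ϖ k).IsUnitary) (hsc : ∀ k, (ϖ k).IsStronglyContinuous)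
            (_ : ∀ k, (ϖ k).IsTopIrreducible)
            (f : κ → C_c(GInf L, ℂ)) (_ : ∀ k, ArchSmooth L 3 (phi3 L) ⇑(f k))
            (_ : ∀ k k', HasArchOpTrace ν (ϖ k) (hu k) (hsc k) (f k') (if k = k' then 1 else 0))
            (_ : ∀ (E : Type) [NormedAddCommGroup E] [InnerProductSpace ℂ E] [CompleteSpace E]
                (π : ContRepresentation ℂ (GInf L) E) (hπu : π.IsUnitary) (hπsc : π.IsStronglyContinuous), π.IsTopIrreducible →
                (∀ k, ¬ ContRepresentation.AreUnitarilyEquivalent (ϖ k) π) → ∀ k, HasArchOpTrace ν π hπu hπsc (f k) 0)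
            (s : κ → ℤ) (_ : ∀ k, s k = 1 ∨ s k = -1) (_ : ∃ k k', s k ≠ s k')
            (EH : Type) (_ : NormedAddCommGroup EH) (_ : InnerProductSpace ℂ EH) (_ : CompleteSpace EH)
            (ρ : ContRepresentation ℂ (HInf L) EH) (huH : ρ.IsUnitary) (hscH : ρ.IsStronglyContinuous),
            IsArchEndoCharId L (archDeltaPP L μ) mH mG ν νH EG ϖ hu hsc s ρ huH hscH ∧
            ∃ k₁ k₂ : κ, s k₁ = 1 ∧ s k₂ = -1 ∧ (∀ ι : L →+* ℂ, CuspG₀ L mG ι ⇑(f k₁ - f k₂)) ∧ IsArchStablyNull L mG ⇑(f k₁ - f k₂) ∧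
              ∃ fH : C_c(HInf L, ℂ), ArchSmooth₂ L ⇑fH ∧ IsArchDeltaTransfer L (phi3 L) (archDeltaPP L μ) mH mG ⇑fH ⇑(f k₁ - f k₂) ∧
                ∀ ι : L →+* ℂ, CuspH₀ L mH ι ⇑fH)
    (hA : ∀ (L : Type) [Field L] [NumberField L] [IsCMField L] [DecidableEq (Pl L)] (μ : HeckeCharacter L) (v : Pl L)
      [MeasurableSpace (HLoc L v)] [BorelSpace (HLoc L v)] [MeasurableSpace (Gqs L v)] [BorelSpace (Gqs L v)]
      (νHv : Measure (HLoc L v)) (νQv : Measure (Gqs L v)) [νHv.IsHaarMeasure] [νHv.IsMulRightInvariant] [νQv.IsHaarMeasure] [νQv.IsMulRightInvariant]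
      [∀ a : HLoc L v, MeasurableSpace (HLoc L v ⧸ Subgroup.centralizer ({a} : Set (HLoc L v)))]
      [∀ a : HLoc L v, BorelSpace (HLoc L v ⧸ Subgroup.centralizer ({a} : Set (HLoc L v)))]
      [∀ γ : Gqs L v, MeasurableSpace (Gqs L v ⧸ Subgroup.centralizer ({γ} : Set (Gqs L v)))]
      [∀ γ : Gqs L v, BorelSpace (Gqs L v ⧸ Subgroup.centralizer ({γ} : Set (Gqs L v)))]
      (mHv : OrbitalMeasureFamily (HLoc L v)) (mQv : OrbitalMeasureFamily (Gqs L v)) (πSt : IrrClass (HLoc L v))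
      [MeasurableSpace (G3 L).Adelic] [BorelSpace (G3 L).Adelic] [MeasurableSpace (H2 L).Adelic] [BorelSpace (H2 L).Adelic]
      [MeasurableSpace (GArch L)] [BorelSpace (GArch L)] [MeasurableSpace (HArch L)] [BorelSpace (HArch L)]
      [MeasurableSpace (H1Loc L v)] [BorelSpace (H1Loc L v)] [MeasurableSpace (H1Arch L)] [BorelSpace (H1Arch L)]
      [MeasurableSpace (H1 L).Adelic] [BorelSpace (H1 L).Adelic],
      (∀ w : PlacesOver L v, IsCMField.complexConj L • w.1 = w.1) → μ.IsUnitary →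
      (∀ x : Literature.NumberTheory.GaloisRepresentations.ideleGroup ↥(maximalRealSubfield L),
        μ (AdeleRing.ideleBaseChange (↥(maximalRealSubfield L)) L x) = quadraticHeckeCharCM L x) →
      (∀ w : Pl L, w ≠ v → ∀ W : PlacesOver L w, Algebra.IsUnramifiedAt (𝓞 ↥(maximalRealSubfield L)) W.1.asIdeal ∧ μ.IsUnramifiedAt W.1) →
      (3 ≤ Module.finrank ℚ ↥(maximalRealSubfield L)) →
      ∀ (ρ₀ : IrrClass (H2Loc L v)), ρ₀.IsAdmissible →
      (letI : MeasurableSpace (H2Loc L v ⧸ Subgroup.center (H2Loc L v)) := borel _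
       ∃ μZ : Measure (H2Loc L v ⧸ Subgroup.center (H2Loc L v)), μZ.IsHaarMeasure ∧ ρ₀.IsSquareIntegrable μZ) →
      ∀ (νGi : Measure (GArch L)) [νGi.IsHaarMeasure] [νGi.IsMulRightInvariant] (νHi : Measure (HArch L)) [νHi.IsHaarMeasure] [νHi.IsMulRightInvariant] (tGi : ∀ γ : GArch L, Measure (Subgroup.centralizer ({γ} : Set (GArch L)))) (tHi : ∀ a : HArch L, Measure (Subgroup.centralizer ({a} : Set (HArch L)))) (mGi : ArchOrbFamG L) (mHi : ArchOrbFamH L)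
        (𝔞 : ArchSignKit L (archDeltaPP L μ) mHi mGi νGi νHi),
      ∃ (μH : Measure (H2 L).automorphicQuotient) (_ : (H2 L).IsAutomorphicMeasure μH) (νH : Measure (H2 L).Adelic) (_ : νH.IsHaarMeasure) (PH : DiscreteAutomorphicRep (H2 L) μH) (ρ₂ : ∀ w : Pl L, IrrClass (H2Loc L w)) (WfH : Type) (_ : AddCommGroup WfH) (_ : Module ℂ WfH) (σfH : Representation ℂ (finAdelic (↥(maximalRealSubfield L)) L (IsCMField.complexConj L) 2 (Matrix.of fun i j : Fin 2 => if i.val + j.val + 1 = 2 then (1 : L) else 0)) WfH),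
        PH.HasFinComponent σfH ∧
        HasLocalClasses L 2 (Matrix.of fun i j : Fin 2 => if i.val + j.val + 1 = 2 then (1 : L) else 0) σfH ρ₂ ∧
        ρ₂ v = ρ₀ ∧
        (∀ w : Pl L, (ρ₂ w).IsAdmissible) ∧
        (∀ w : Pl L, w ≠ v → (ρ₂ w).IsSpherical (cmLocalIntegralLevel L 2 (Matrix.of fun i j : Fin 2 => if i.val + j.val + 1 = 2 then (1 : L) else 0) w)) ∧
        (letI := 𝔞.instNACGH; letI := 𝔞.instIPSH; letI := 𝔞.instCSH; AT L μH PH 𝔞.EH 𝔞.ρH))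
    (hB : ∀ (L : Type) [Field L] [NumberField L] [IsCMField L] [DecidableEq (Pl L)] (μ : HeckeCharacter L) (v : Pl L)
      [MeasurableSpace (HLoc L v)] [BorelSpace (HLoc L v)] [MeasurableSpace (Gqs L v)] [BorelSpace (Gqs L v)]
      (νHv : Measure (HLoc L v)) (νQv : Measure (Gqs L v)) [νHv.IsHaarMeasure] [νHv.IsMulRightInvariant] [νQv.IsHaarMeasure] [νQv.IsMulRightInvariant]
      [∀ a : HLoc L v, MeasurableSpace (HLoc L v ⧸ Subgroup.centralizer ({a} : Set (HLoc L v)))]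
      [∀ a : HLoc L v, BorelSpace (HLoc L v ⧸ Subgroup.centralizer ({a} : Set (HLoc L v)))]
      [∀ γ : Gqs L v, MeasurableSpace (Gqs L v ⧸ Subgroup.centralizer ({γ} : Set (Gqs L v)))]
      [∀ γ : Gqs L v, BorelSpace (Gqs L v ⧸ Subgroup.centralizer ({γ} : Set (Gqs L v)))]
      (mHv : OrbitalMeasureFamily (HLoc L v)) (mQv : OrbitalMeasureFamily (Gqs L v)) (πSt : IrrClass (HLoc L v))
      [MeasurableSpace (G3 L).Adelic] [BorelSpace (G3 L).Adelic] [MeasurableSpace (H2 L).Adelic] [BorelSpace (H2 L).Adelic]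
      [MeasurableSpace (GArch L)] [BorelSpace (GArch L)] [MeasurableSpace (HArch L)] [BorelSpace (HArch L)]
      [MeasurableSpace (H1Loc L v)] [BorelSpace (H1Loc L v)] [MeasurableSpace (H1Arch L)] [BorelSpace (H1Arch L)]
      [MeasurableSpace (H1 L).Adelic] [BorelSpace (H1 L).Adelic],
      ∀ (μH : Measure (H2 L).automorphicQuotient) [(H2 L).IsAutomorphicMeasure μH] (νH : Measure (H2 L).Adelic) [νH.IsHaarMeasure] (PH : DiscreteAutomorphicRep (H2 L) μH) (ρ₂ : ∀ w : Pl L, IrrClass (H2Loc L w)) (WfH : Type) [AddCommGroup WfH] [Module ℂ WfH] (σfH : Representation ℂ (finAdelic (↥(maximalRealSubfield L)) L (IsCMField.complexConj L) 2 (Matrix.of fun i j : Fin 2 => if i.val + j.val + 1 = 2 then (1 : L) else 0)) WfH) (hPσfH : PH.HasFinComponent σfH) (hσfH : HasLocalClasses L 2 (Matrix.of fun i j : Fin 2 => if i.val + j.val + 1 = 2 then (1 : L) else 0) σfH ρ₂),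
      ∃ (J : Type) (_ : Finite J) (dρ : J → DiscreteClass (H2 L) μH),
        Function.Injective dρ ∧
        DiscreteClass.mk PH ∈ Set.range dρ ∧
        (∀ j, IsLinked L 2 (Matrix.of fun i j : Fin 2 => if i.val + j.val + 1 = 2 then (1 : L) else 0) μH (dρ j) ρ₂) ∧
        (∀ j, (dρ j).mult = 1) ∧
        ∀ d : DiscreteClass (H2 L) μH, IsLinked L 2 (Matrix.of fun i j : Fin 2 => if i.val + j.val + 1 = 2 then (1 : L) else 0) μH d ρ₂ → d ∈ Set.range dρ)
    (hC : ∀ (L : Type) [Field L] [NumberField L] [IsCMField L] [DecidableEq (Pl L)] (μ : HeckeCharacter L) (v : Pl L)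
      [MeasurableSpace (HLoc L v)] [BorelSpace (HLoc L v)] [MeasurableSpace (Gqs L v)] [BorelSpace (Gqs L v)]
      (νHv : Measure (HLoc L v)) (νQv : Measure (Gqs L v)) [νHv.IsHaarMeasure] [νHv.IsMulRightInvariant] [νQv.IsHaarMeasure] [νQv.IsMulRightInvariant]
      [∀ a : HLoc L v, MeasurableSpace (HLoc L v ⧸ Subgroup.centralizer ({a} : Set (HLoc L v)))]
      [∀ a : HLoc L v, BorelSpace (HLoc L v ⧸ Subgroup.centralizer ({a} : Set (HLoc L v)))]
      [∀ γ : Gqs L v, MeasurableSpace (Gqs L v ⧸ Subgroup.centralizer ({γ} : Set (Gqs L v)))]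
      [∀ γ : Gqs L v, BorelSpace (Gqs L v ⧸ Subgroup.centralizer ({γ} : Set (Gqs L v)))]
      (mHv : OrbitalMeasureFamily (HLoc L v)) (mQv : OrbitalMeasureFamily (Gqs L v)) (πSt : IrrClass (HLoc L v))
      [MeasurableSpace (G3 L).Adelic] [BorelSpace (G3 L).Adelic] [MeasurableSpace (H2 L).Adelic] [BorelSpace (H2 L).Adelic]
      [MeasurableSpace (GArch L)] [BorelSpace (GArch L)] [MeasurableSpace (HArch L)] [BorelSpace (HArch L)]
      [MeasurableSpace (H1Loc L v)] [BorelSpace (H1Loc L v)] [MeasurableSpace (H1Arch L)] [BorelSpace (H1Arch L)]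
      [MeasurableSpace (H1 L).Adelic] [BorelSpace (H1 L).Adelic] (ξ : OneDimAutRepH L),
      (∀ w : PlacesOver L v, IsCMField.complexConj L • w.1 = w.1) → μ.IsUnitary →
      (∀ x : Literature.NumberTheory.GaloisRepresentations.ideleGroup ↥(maximalRealSubfield L),
        μ (AdeleRing.ideleBaseChange (↥(maximalRealSubfield L)) L x) = quadraticHeckeCharCM L x) →
      (∀ w : Pl L, w ≠ v → ∀ W : PlacesOver L w, Algebra.IsUnramifiedAt (𝓞 ↥(maximalRealSubfield L)) W.1.asIdeal ∧ μ.IsUnramifiedAt W.1) →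
      (3 ≤ Module.finrank ℚ ↥(maximalRealSubfield L)) →
      ∃ (μ₁ : Measure (H1 L).automorphicQuotient) (_ : (H1 L).IsAutomorphicMeasure μ₁) (θ : ∀ w : Pl L, IrrClass (H1Loc L w)) (χθ : ∀ w : Pl L, H1Loc L w →* ℂˣ) (hχθ : ∀ w : Pl L, IsOpen ((χθ w).ker : Set (H1Loc L w))) (ν₁v : Measure (H1Loc L v)) (χv : H1Loc L v → ℂ) (ν₁i : Measure (H1Arch L)) (χi : H1Arch L → ℂ) (ν₁ : Measure (H1 L).Adelic) (_ : ν₁.IsHaarMeasure) (d₁ : DiscreteClass (H1 L) μ₁),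
        cmOccursInDiscreteSpectrum L 1 (Matrix.of fun i j : Fin 1 => if i.val + j.val + 1 = 1 then (1 : L) else 0) μ₁ θ ∧
        (∀ w : Pl L, θ w = IrrClass.mk (SmoothIrrep.ofChar (χθ w) (hχθ w))) ∧
        (χθ v = (torusLocalComponent L (IsCMField.complexConj L) v ξ.ψ).comp (localDet (IsCMField.complexConj L) v (isUnit_antidiagOne_det L 1))) ∧
        (∀ w : Pl L, w ≠ v → ∀ k ∈ (cmLocalIntegralLevel L 1 (Matrix.of fun i j : Fin 1 => if i.val + j.val + 1 = 1 then (1 : L) else 0) w), χθ w k = 1) ∧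
        (χv = fun z => ((χθ v z : ℂˣ) : ℂ)) ∧
        (∀ f₁ : H1Loc L v → ℂ, IsLocSmooth f₁ → (θ v).smoothTrace ν₁v f₁ = ∫ z, f₁ z * χv z ∂ν₁v) ∧
        IsLinked L 1 (Matrix.of fun i j : Fin 1 => if i.val + j.val + 1 = 1 then (1 : L) else 0) μ₁ d₁ θ ∧
        d₁.mult = 1 ∧
        (∀ (gi : H1Arch L → ℂ) (gv : H1Loc L v → ℂ), ArchSmooth L 1 (Matrix.of fun i j : Fin 1 => if i.val + j.val + 1 = 1 then (1 : L) else 0) gi → IsLocSmooth gv →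
    ∀ (Φ₁ : (H1Loc L v → ℂ) → C_c((H1 L).Adelic, ℂ)),
      (∀ g₁ : H1Loc L v → ℂ, IsLocSmooth g₁ → ∀ z : (H1 L).Adelic,
        Φ₁ g₁ z = gi (UnitaryGroup.archPart (↥(maximalRealSubfield L)) L (IsCMField.complexConj L) 1
            (Matrix.of fun i j : Fin 1 => if i.val + j.val + 1 = 1 then (1 : L) else 0) z) *
          (g₁ ((H1 L).toLocal v z) *
            ∏ᶠ w : {w : Pl L // w ≠ v}, Set.indicator ((cmLocalIntegralLevel L 1 (Matrix.of fun i j : Fin 1 => if i.val + j.val + 1 = 1 then (1 : L) else 0) w.1) : Set (H1Loc L w.1)) (fun _ => (1 : ℂ)) ((H1 L).toLocal w.1 z))) →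
      d₁.classTrace ν₁ (Φ₁ gv) = ((d₁.mult).toNat : ℂ) * (∫ z, gi z * χi z ∂ν₁i) * (θ v).smoothTrace ν₁v gv) ∧
        Continuous χi ∧
        IsFiniteMeasureOnCompacts ν₁i)
    (hD : ∀ (L : Type) [Field L] [NumberField L] [IsCMField L] [DecidableEq (Pl L)] (μ : HeckeCharacter L) (v : Pl L)
      [MeasurableSpace (HLoc L v)] [BorelSpace (HLoc L v)] [MeasurableSpace (Gqs L v)] [BorelSpace (Gqs L v)]
      (νHv : Measure (HLoc L v)) (νQv : Measure (Gqs L v)) [νHv.IsHaarMeasure] [νHv.IsMulRightInvariant] [νQv.IsHaarMeasure] [νQv.IsMulRightInvariant]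
      [∀ a : HLoc L v, MeasurableSpace (HLoc L v ⧸ Subgroup.centralizer ({a} : Set (HLoc L v)))]
      [∀ a : HLoc L v, BorelSpace (HLoc L v ⧸ Subgroup.centralizer ({a} : Set (HLoc L v)))]
      [∀ γ : Gqs L v, MeasurableSpace (Gqs L v ⧸ Subgroup.centralizer ({γ} : Set (Gqs L v)))]
      [∀ γ : Gqs L v, BorelSpace (Gqs L v ⧸ Subgroup.centralizer ({γ} : Set (Gqs L v)))]
      (mHv : OrbitalMeasureFamily (HLoc L v)) (mQv : OrbitalMeasureFamily (Gqs L v)) (πSt : IrrClass (HLoc L v))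
      [MeasurableSpace (G3 L).Adelic] [BorelSpace (G3 L).Adelic] [MeasurableSpace (H2 L).Adelic] [BorelSpace (H2 L).Adelic]
      [MeasurableSpace (GArch L)] [BorelSpace (GArch L)] [MeasurableSpace (HArch L)] [BorelSpace (HArch L)]
      [MeasurableSpace (H1Loc L v)] [BorelSpace (H1Loc L v)] [MeasurableSpace (H1Arch L)] [BorelSpace (H1Arch L)]
      [MeasurableSpace (H1 L).Adelic] [BorelSpace (H1 L).Adelic],
      ∀ (ρ₂ : ∀ w : Pl L, IrrClass (H2Loc L w)), (∀ w : Pl L, (ρ₂ w).IsAdmissible) →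
      (∀ w : Pl L, w ≠ v → (ρ₂ w).IsSpherical (cmLocalIntegralLevel L 2 (Matrix.of fun i j : Fin 2 => if i.val + j.val + 1 = 2 then (1 : L) else 0) w)) →
      ∀ (χθ : ∀ w : Pl L, H1Loc L w →* ℂˣ) (hχθ : ∀ w : Pl L, IsOpen ((χθ w).ker : Set (H1Loc L w))),
      (∀ w : Pl L, w ≠ v → ∀ k ∈ (cmLocalIntegralLevel L 1 (Matrix.of fun i j : Fin 1 => if i.val + j.val + 1 = 1 then (1 : L) else 0) w), χθ w k = 1) →
      ∀ (θ : ∀ w : Pl L, IrrClass (H1Loc L w)), (∀ w : Pl L, θ w = IrrClass.mk (SmoothIrrep.ofChar (χθ w) (hχθ w))) →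
      πSt = IrrClass.boxChar (χθ v) (hχθ v) (ρ₂ v) →
      ∀ [Fact (∀ w, IsOpen (((cmLocalIntegralLevel L 2 (Matrix.of fun i j : Fin 2 => if i.val + j.val + 1 = 2 then (1 : L) else 0) w).prod (cmLocalIntegralLevel L 1 (Matrix.of fun i j : Fin 1 => if i.val + j.val + 1 = 1 then (1 : L) else 0) w)) : Set (HLoc L w)))],
      ∃ (V : Pl L → Type) (_ : ∀ w, AddCommGroup (V w)) (_ : ∀ w, Module ℂ (V w)) (ρ : ∀ w, Representation ℂ (HLoc L w) (V w)) (x₀ : ∀ w, V w) (W : Type) (_ : AddCommGroup W) (_ : Module ℂ W) (σH : Representation ℂ (Πʳ w : Pl L, [HLoc L w, ((cmLocalIntegralLevel L 2 (Matrix.of fun i j : Fin 2 => if i.val + j.val + 1 = 2 then (1 : L) else 0) w).prod (cmLocalIntegralLevel L 1 (Matrix.of fun i j : Fin 1 => if i.val + j.val + 1 = 1 then (1 : L) else 0) w))]) W) (hx₀ : ∀ᶠ w in cofinite, x₀ w ∈ (ρ w).fixedPoints (((cmLocalIntegralLevel L 2 (Matrix.of fun i j : Fin 2 => if i.val + j.val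 + 1 = 2 then (1 : L) else 0) w).prod (cmLocalIntegralLevel L 1 (Matrix.of fun i j : Fin 1 => if i.val + j.val + 1 = 1 then (1 : L) else 0) w)))) (j : RestrictedFamily V x₀ → W),
        IsRestrictedTensorProductRep ρ σH hx₀ j ({v} : Finset (Pl L)) ∧
        (∀ w, w ≠ v → (ρ w).fixedPoints (((cmLocalIntegralLevel L 2 (Matrix.of fun i j : Fin 2 => if i.val + j.val + 1 = 2 then (1 : L) else 0) w).prod (cmLocalIntegralLevel L 1 (Matrix.of fun i j : Fin 1 => if i.val + j.val + 1 = 1 then (1 : L) else 0) w))) = ℂ ∙ x₀ w) ∧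
        (∀ w, (ρ w).IsAdmissible) ∧
        (∀ w, (ρ₂ w).IsConstituentOf ((ρ w).comp (MonoidHom.inl _ _))) ∧
        (∀ w, (θ w).IsConstituentOf ((ρ w).comp (MonoidHom.inr _ _))) ∧
        πSt.smoothTrace νHv = (ρ v).smoothTrace νHv)
    (hF : ∀ (L : Type) [Field L] [NumberField L] [IsCMField L] [DecidableEq (Pl L)] (μ : HeckeCharacter L) (v : Pl L)
      [MeasurableSpace (HLoc L v)] [BorelSpace (HLoc L v)] [MeasurableSpace (Gqs L v)] [BorelSpace (Gqs L v)]
      (νHv : Measure (HLoc L v)) (νQv : Measure (Gqs L v)) [νHv.IsHaarMeasure] [νHv.IsMulRightInvariant] [νQv.IsHaarMeasure] [νQv.IsMulRightInvariant]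
      [∀ a : HLoc L v, MeasurableSpace (HLoc L v ⧸ Subgroup.centralizer ({a} : Set (HLoc L v)))]
      [∀ a : HLoc L v, BorelSpace (HLoc L v ⧸ Subgroup.centralizer ({a} : Set (HLoc L v)))]
      [∀ γ : Gqs L v, MeasurableSpace (Gqs L v ⧸ Subgroup.centralizer ({γ} : Set (Gqs L v)))]
      [∀ γ : Gqs L v, BorelSpace (Gqs L v ⧸ Subgroup.centralizer ({γ} : Set (Gqs L v)))]
      (mHv : OrbitalMeasureFamily (HLoc L v)) (mQv : OrbitalMeasureFamily (Gqs L v)) (πSt : IrrClass (HLoc L v))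
      [MeasurableSpace (G3 L).Adelic] [BorelSpace (G3 L).Adelic] [MeasurableSpace (H2 L).Adelic] [BorelSpace (H2 L).Adelic]
      [MeasurableSpace (GArch L)] [BorelSpace (GArch L)] [MeasurableSpace (HArch L)] [BorelSpace (HArch L)]
      [MeasurableSpace (H1Loc L v)] [BorelSpace (H1Loc L v)] [MeasurableSpace (H1Arch L)] [BorelSpace (H1Arch L)]
      [MeasurableSpace (H1 L).Adelic] [BorelSpace (H1 L).Adelic] (ξ : OneDimAutRepH L),
      (∀ w : PlacesOver L v, IsCMField.complexConj L • w.1 = w.1) → μ.IsUnitary →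
      (∀ x : Literature.NumberTheory.GaloisRepresentations.ideleGroup ↥(maximalRealSubfield L),
        μ (AdeleRing.ideleBaseChange (↥(maximalRealSubfield L)) L x) = quadraticHeckeCharCM L x) →
      (∀ w : Pl L, w ≠ v → ∀ W : PlacesOver L w, Algebra.IsUnramifiedAt (𝓞 ↥(maximalRealSubfield L)) W.1.asIdeal ∧ μ.IsUnramifiedAt W.1) →
      (3 ≤ Module.finrank ℚ ↥(maximalRealSubfield L)) →
      ∀ (νGi : Measure (GArch L)) [νGi.IsHaarMeasure] [νGi.IsMulRightInvariant] (νHi : Measure (HArch L)) [νHi.IsHaarMeasure] [νHi.IsMulRightInvariant] (tGi : ∀ γ : GArch L, Measure (Subgroup.centralizer ({γ} : Set (GArch L)))) (tHi : ∀ a : HArch L, Measure (Subgroup.centralizer ({a} : Set (HArch L)))) (mGi : ArchOrbFamG L) (mHi : ArchOrbFamH L)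
        (𝔞 : ArchSignKit L (archDeltaPP L μ) mHi mGi νGi νHi)
        (μH : Measure (H2 L).automorphicQuotient) [(H2 L).IsAutomorphicMeasure μH] (νH : Measure (H2 L).Adelic) [νH.IsHaarMeasure] (PH : DiscreteAutomorphicRep (H2 L) μH) (ρ₂ : ∀ w : Pl L, IrrClass (H2Loc L w)) (WfH : Type) [AddCommGroup WfH] [Module ℂ WfH] (σfH : Representation ℂ (finAdelic (↥(maximalRealSubfield L)) L (IsCMField.complexConj L) 2 (Matrix.of fun i j : Fin 2 => if i.val + j.val + 1 = 2 then (1 : L) else 0)) WfH) (hPσfH : PH.HasFinComponent σfH) (hσfH : HasLocalClasses L 2 (Matrix.of fun i j : Fin 2 => if i.val + j.val + 1 = 2 then (1 : L) else 0) σfH ρ₂),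
      (letI := 𝔞.instNACGH; letI := 𝔞.instIPSH; letI := 𝔞.instCSH; AT L μH PH 𝔞.EH 𝔞.ρH) →
      ∀ (J : Type) [Finite J] (dρ : J → DiscreteClass (H2 L) μH) (hinjH : Function.Injective dρ) (hPHmem : DiscreteClass.mk PH ∈ Set.range dρ) (hlinkH : ∀ j, IsLinked L 2 (Matrix.of fun i j : Fin 2 => if i.val + j.val + 1 = 2 then (1 : L) else 0) μH (dρ j) ρ₂) (hdρ : ∀ j, (dρ j).mult = 1) (hexhH : ∀ d : DiscreteClass (H2 L) μH, IsLinked L 2 (Matrix.of fun i j : Fin 2 => if i.val + j.val + 1 = 2 then (1 : L) else 0) μH d ρ₂ → d ∈ Set.range dρ)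
        (μ₁ : Measure (H1 L).automorphicQuotient) [(H1 L).IsAutomorphicMeasure μ₁] (θ : ∀ w : Pl L, IrrClass (H1Loc L w)) (χθ : ∀ w : Pl L, H1Loc L w →* ℂˣ) (hχθ : ∀ w : Pl L, IsOpen ((χθ w).ker : Set (H1Loc L w))) (ν₁v : Measure (H1Loc L v)) (χv : H1Loc L v → ℂ) (ν₁i : Measure (H1Arch L)) (χi : H1Arch L → ℂ) (ν₁ : Measure (H1 L).Adelic) [ν₁.IsHaarMeasure] (d₁ : DiscreteClass (H1 L) μ₁) (hθ : cmOccursInDiscreteSpectrum L 1 (Matrix.of fun i j : Fin 1 => if i.val + j.val + 1 = 1 then (1 : L) else 0) μ₁ θ) (hθχ : ∀ w : Pl L, θ w = IrrClass.mk (SmoothIrrep.ofChar (χθ w) (hχθ w))) (hχθK : ∀ w : Pl L, w ≠ v → ∀ k ∈ (cmLocalIntegralLevel L 1 (Matrix.of fun i j : Fin 1 => if i.val + j.val + 1 = 1 then (1 : L) else 0) w), χθ w k = 1) (hχvθ : χv = fun z => ((χθ v z : ℂˣ) : ℂ)) (hχv : ∀ f₁ : H1Loc L v → ℂ, IsLocSmooth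 f₁ → (θ v).smoothTrace ν₁v f₁ = ∫ z, f₁ z * χv z ∂ν₁v) (hlink₁ : IsLinked L 1 (Matrix.of fun i j : Fin 1 => if i.val + j.val + 1 = 1 then (1 : L) else 0) μ₁ d₁ θ) (hd₁ : d₁.mult = 1) (hθi : ∀ (gi : H1Arch L → ℂ) (gv : H1Loc L v → ℂ), ArchSmooth L 1 (Matrix.of fun i j : Fin 1 => if i.val + j.val + 1 = 1 then (1 : L) else 0) gi → IsLocSmooth gv →
    ∀ (Φ₁ : (H1Loc L v → ℂ) → C_c((H1 L).Adelic, ℂ)),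
      (∀ g₁ : H1Loc L v → ℂ, IsLocSmooth g₁ → ∀ z : (H1 L).Adelic,
        Φ₁ g₁ z = gi (UnitaryGroup.archPart (↥(maximalRealSubfield L)) L (IsCMField.complexConj L) 1
            (Matrix.of fun i j : Fin 1 => if i.val + j.val + 1 = 1 then (1 : L) else 0) z) *
          (g₁ ((H1 L).toLocal v z) *
            ∏ᶠ w : {w : Pl L // w ≠ v}, Set.indicator ((cmLocalIntegralLevel L 1 (Matrix.of fun i j : Fin 1 => if i.val + j.val + 1 = 1 then (1 : L) else 0) w.1) : Set (H1Loc L w.1)) (fun _ => (1 : ℂ)) ((H1 L).toLocal w.1 z))) →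
      d₁.classTrace ν₁ (Φ₁ gv) = ((d₁.mult).toNat : ℂ) * (∫ z, gi z * χi z ∂ν₁i) * (θ v).smoothTrace ν₁v gv)
        [Fact (∀ w, IsOpen (((cmLocalIntegralLevel L 2 (Matrix.of fun i j : Fin 2 => if i.val + j.val + 1 = 2 then (1 : L) else 0) w).prod (cmLocalIntegralLevel L 1 (Matrix.of fun i j : Fin 1 => if i.val + j.val + 1 = 1 then (1 : L) else 0) w)) : Set (HLoc L w)))] (V : Pl L → Type) [∀ w, AddCommGroup (V w)] [∀ w, Module ℂ (V w)] (ρ : ∀ w, Representation ℂ (HLoc L w) (V w)) (x₀ : ∀ w, V w) (W : Type) [AddCommGroup W] [Module ℂ W] (σH : Representation ℂ (Πʳ w : Pl L, [HLoc L w, ((cmLocalIntegralLevel L 2 (Matrix.of fun i j : Fin 2 => if i.val + j.val + 1 = 2 then (1 : L) else 0) w).prod (cmLocalIntegralLevel L 1 (Matrix.of fun i j : Fin 1 => if i.val + j.val + 1 = 1 then (1 : L) else 0) w))]) W) (hx₀ : ∀ᶠ w in cofinite, x₀ w ∈ (ρ w).fixedPoints (((cmLocalIntegralLevel L 2 (Matrix.of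 fun i j : Fin 2 => if i.val + j.val + 1 = 2 then (1 : L) else 0) w).prod (cmLocalIntegralLevel L 1 (Matrix.of fun i j : Fin 1 => if i.val + j.val + 1 = 1 then (1 : L) else 0) w)))) (j : RestrictedFamily V x₀ → W) (hσH : IsRestrictedTensorProductRep ρ σH hx₀ j ({v} : Finset (Pl L))) (hline : ∀ w, w ≠ v → (ρ w).fixedPoints (((cmLocalIntegralLevel L 2 (Matrix.of fun i j : Fin 2 => if i.val + j.val + 1 = 2 then (1 : L) else 0) w).prod (cmLocalIntegralLevel L 1 (Matrix.of fun i j : Fin 1 => if i.val + j.val + 1 = 1 then (1 : L) else 0) w))) = ℂ ∙ x₀ w) (hadm : ∀ w, (ρ w).IsAdmissible) (hfac₂ : ∀ w, (ρ₂ w).IsConstituentOf ((ρ w).comp (MonoidHom.inl _ _))) (hfac₁ : ∀ w, (θ w).IsConstituentOf ((ρ w).comp (MonoidHom.inr _ _))) (hpin : πSt.smoothTrace νHv = (ρ v).smoothTrace νHv),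
      letI : MeasurableSpace (Πʳ w : Pl L, [HLoc L w, ((cmLocalIntegralLevel L 2 (Matrix.of fun i j : Fin 2 => if i.val + j.val + 1 = 2 then (1 : L) else 0) w).prod (cmLocalIntegralLevel L 1 (Matrix.of fun i j : Fin 1 => if i.val + j.val + 1 = 1 then (1 : L) else 0) w))]) := borel _
      ∀ (νfH : @Measure (Πʳ w : Pl L, [HLoc L w, ((cmLocalIntegralLevel L 2 (Matrix.of fun i j : Fin 2 => if i.val + j.val + 1 = 2 then (1 : L) else 0) w).prod (cmLocalIntegralLevel L 1 (Matrix.of fun i j : Fin 1 => if i.val + j.val + 1 = 1 then (1 : L) else 0) w))]) (borel _))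
        (hνfH : ∀ K' : Subgroup (HLoc L v), IsOpen (K' : Set (HLoc L v)) → IsCompact (K' : Set (HLoc L v)) →
          νfH.real {g : Πʳ w : Pl L, [HLoc L w, ((cmLocalIntegralLevel L 2 (Matrix.of fun i j : Fin 2 => if i.val + j.val + 1 = 2 then (1 : L) else 0) w).prod (cmLocalIntegralLevel L 1 (Matrix.of fun i j : Fin 1 => if i.val + j.val + 1 = 1 then (1 : L) else 0) w))] | g v ∈ K' ∧ ∀ w, w ≠ v → g w ∈ ((cmLocalIntegralLevel L 2 (Matrix.of fun i j : Fin 2 => if i.val + j.val + 1 = 2 then (1 : L) else 0) w).prod (cmLocalIntegralLevel L 1 (Matrix.of fun i j : Fin 1 => if i.val + j.val + 1 = 1 then (1 : L) else 0) w))} = νHv.real (K' : Set (HLoc L v))),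
      ∀ (FH : C_c(HArch L, ℂ)) (c : ℂ), ArchSmooth₂ L ⇑FH → (letI := 𝔞.instNACGH; letI := 𝔞.instIPSH; letI := 𝔞.instCSH; HasArchOpTrace νHi 𝔞.ρH 𝔞.huH 𝔞.hscH FH c) →
    ∀ (F₂ : H2Arch L → ℂ), (∀ h₂ : H2Arch L, F₂ h₂ = ∫ z, FH (h₂, z) * χi z ∂ν₁i) →
    ∀ (Φ : (HLoc L v → ℂ) → C_c((H2 L).Adelic, ℂ)),
      (∀ fH : HLoc L v → ℂ, IsLocSmooth fH → ∀ h : (H2 L).Adelic,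
        Φ fH h = F₂ (UnitaryGroup.archPart (↥(maximalRealSubfield L)) L (IsCMField.complexConj L) 2
            (Matrix.of fun i j : Fin 2 => if i.val + j.val + 1 = 2 then (1 : L) else 0) h) *
          (xiReduce ν₁v χv fH ((H2 L).toLocal v h) *
            ∏ᶠ w : {w : Pl L // w ≠ v}, Set.indicator ((cmLocalIntegralLevel L 2 (Matrix.of fun i j : Fin 2 => if i.val + j.val + 1 = 2 then (1 : L) else 0) w.1) : Set (H2Loc L w.1)) (fun _ => (1 : ℂ)) ((H2 L).toLocal w.1 h))) →
    ∀ (fH : HLoc L v → ℂ) (φ : Gqs L v → ℂ), MatchE1 L μ v mHv mQv fH φ →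
      ∑ᶠ j, (((dρ j).mult).toNat : ℂ) * (dρ j).classTrace νH (Φ fH) =
        c * σH.smoothTrace νfH (fun g : Πʳ w : Pl L, [HLoc L w, ((cmLocalIntegralLevel L 2 (Matrix.of fun i j : Fin 2 => if i.val + j.val + 1 = 2 then (1 : L) else 0) w).prod (cmLocalIntegralLevel L 1 (Matrix.of fun i j : Fin 1 => if i.val + j.val + 1 = 1 then (1 : L) else 0) w))] => fH (g v) *
          Set.indicator {g : Πʳ w : Pl L, [HLoc L w, ((cmLocalIntegralLevel L 2 (Matrix.of fun i j : Fin 2 => if i.val + j.val + 1 = 2 then (1 : L) else 0) w).prod (cmLocalIntegralLevel L 1 (Matrix.of fun i j : Fin 1 => if i.val + j.val + 1 = 1 then (1 : L) else 0) w))] | ∀ w, w ≠ v → g w ∈ ((cmLocalIntegralLevel L 2 (Matrix.of fun i j : Fin 2 => if i.val + j.val + 1 = 2 then (1 : L) else 0) w).prod (cmLocalIntegralLevel L 1 (Matrix.of fun i j : Fin 1 => if i.val + j.val + 1 = 1 then (1 : L) else 0) w))} (fun _ => (1 : ℂ)) g)) :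
    ∀ (L : Type) [Field L] [NumberField L] [IsCMField L] (μ : HeckeCharacter L) (ξ : OneDimAutRepH L) (v : Pl L),
      (∀ w : PlacesOver L v, IsCMField.complexConj L • w.1 = w.1) → μ.IsUnitary →
      (∀ x : Literature.NumberTheory.GaloisRepresentations.ideleGroup ↥(maximalRealSubfield L),
        μ (AdeleRing.ideleBaseChange (↥(maximalRealSubfield L)) L x) = quadraticHeckeCharCM L x) →
      (∀ w : Pl L, w ≠ v → ∀ W : PlacesOver L w, Algebra.IsUnramifiedAt (𝓞 ↥(maximalRealSubfield L)) W.1.asIdeal ∧ μ.IsUnramifiedAt W.1) →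
      (3 ≤ Module.finrank ℚ ↥(maximalRealSubfield L)) →
      ∀ [MeasurableSpace (HLoc L v)] [BorelSpace (HLoc L v)] [MeasurableSpace (Gqs L v)] [BorelSpace (Gqs L v)]
        (νHv : Measure (HLoc L v)) (νQv : Measure (Gqs L v))
        [νHv.IsHaarMeasure] [νHv.IsMulRightInvariant] [νQv.IsHaarMeasure] [νQv.IsMulRightInvariant],
      letI : ∀ a : HLoc L v, MeasurableSpace (HLoc L v ⧸ Subgroup.centralizer ({a} : Set (HLoc L v))) := fun _ => borel _
      haveI : ∀ a : HLoc L v, BorelSpace (HLoc L v ⧸ Subgroup.centralizer ({a} : Set (HLoc L v))) := fun _ => ⟨rfl⟩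
      letI : ∀ γ : Gqs L v, MeasurableSpace (Gqs L v ⧸ Subgroup.centralizer ({γ} : Set (Gqs L v))) := fun _ => borel _
      haveI : ∀ γ : Gqs L v, BorelSpace (Gqs L v ⧸ Subgroup.centralizer ({γ} : Set (Gqs L v))) := fun _ => ⟨rfl⟩
      ∀ (mHv : OrbitalMeasureFamily (HLoc L v)) (mQv : OrbitalMeasureFamily (Gqs L v)),
        mHv.IsCanonical (IsLocalGRegular L v) νHv →
        mQv.IsCanonical (fun γ => IsRegularElt (γ.val : GL (Fin 3) (UnitaryGroup.LocalRing L v))) νQv →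
        ∀ (π₁ πSt : IrrClass (HLoc L v)),
          HLengthTwoLabels L v
            (torusCharPair (conjLocal L (IsCMField.complexConj L) v) (cmLocalForm L 2 v) (cmLocalForm_eq_over L 2 v) 0
              ((torusLocalComponent L (IsCMField.complexConj L) v ξ.η).comp
                  (quotConj (conjLocal L (IsCMField.complexConj L) v) (conjLocal_conjLocal_cm L v)) *
                halfModulusChar (UnitaryGroup.LocalRing L v))
              (torusLocalComponent L (IsCMField.complexConj L) v ξ.ψ))
            ((torusLocalComponent L (IsCMField.complexConj L) v ξ.ψ).comp (localDet (IsCMField.complexConj L) v (isUnit_antidiagOne_det L 1))) π₁ πSt →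
          (∀ fH : HLoc L v → ℂ, IsLocSmooth fH → π₁.smoothTrace νHv fH = charDist (ξ.xiLocalChar v) νHv fH) →
          ∀ [DecidableEq (Pl L)] [MeasurableSpace (G3 L).Adelic] [BorelSpace (G3 L).Adelic] [MeasurableSpace (H2 L).Adelic] [BorelSpace (H2 L).Adelic]
            [MeasurableSpace (GArch L)] [BorelSpace (GArch L)] [MeasurableSpace (HArch L)] [BorelSpace (HArch L)]
            [MeasurableSpace (H1Loc L v)] [BorelSpace (H1Loc L v)] [MeasurableSpace (H1Arch L)] [BorelSpace (H1Arch L)]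
            [MeasurableSpace (H1 L).Adelic] [BorelSpace (H1 L).Adelic],
          ∀ (ι₁ ι₂ : L →+* ℂ), NumberField.InfinitePlace.mk ι₁ ≠ NumberField.InfinitePlace.mk ι₂ →
          ∀ (ρ₀ : IrrClass ((UnitaryGroup.cmDatum L 2 (Matrix.of fun i j : Fin 2 => if i.val + j.val + 1 = 2 then (1 : L) else 0)).Local v))
            (hχ : IsOpen ((((torusLocalComponent L (IsCMField.complexConj L) v ξ.ψ).comp (localDet (IsCMField.complexConj L) v (isUnit_antidiagOne_det L 1))).ker : Subgroup ↥(UnitaryGroup.«local» L (IsCMField.complexConj L) 1 (Matrix.of fun i j : Fin 1 => if i.val + j.val + 1 = 1 then (1 : L) else 0) v)) : Set ↥(UnitaryGroup.«local» L (IsCMField.complexConj L) 1 (Matrix.of fun i j : Fin 1 => if i.val + j.val + 1 = 1 then (1 : L) else 0) v))),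
            ρ₀.IsAdmissible →
            (letI : MeasurableSpace ((UnitaryGroup.cmDatum L 2 (Matrix.of fun i j : Fin 2 => if i.val + j.val + 1 = 2 then (1 : L) else 0)).Local v ⧸ Subgroup.center ((UnitaryGroup.cmDatum L 2 (Matrix.of fun i j : Fin 2 => if i.val + j.val + 1 = 2 then (1 : L) else 0)).Local v)) := borel _
             ∃ μZ : Measure ((UnitaryGroup.cmDatum L 2 (Matrix.of fun i j : Fin 2 => if i.val + j.val + 1 = 2 then (1 : L) else 0)).Local v ⧸ Subgroup.center ((UnitaryGroup.cmDatum L 2 (Matrix.of fun i j : Fin 2 => if i.val + j.val + 1 = 2 then (1 : L) else 0)).Local v)), μZ.IsHaarMeasure ∧ ρ₀.IsSquareIntegrable μZ) →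
            IrrClass.boxChar ((torusLocalComponent L (IsCMField.complexConj L) v ξ.ψ).comp (localDet (IsCMField.complexConj L) v (isUnit_antidiagOne_det L 1))) hχ ρ₀ = πSt →
            ∃ 𝔥 : S10HDatum₂ L μ v νHv νQv mHv mQv πSt (R90.S2.CuspG₀ L) (R90.S2.CuspH₀ L), 𝔥.ρ₂ v = ρ₀ ∧ 𝔥.ι₁ = ι₁ ∧ 𝔥.ι₂ = ι₂ ∧ (Continuous 𝔥.χi ∧ IsFiniteMeasureOnCompacts 𝔥.ν₁i) := by
  intro L _ _ _ μ ξ v hv hμu hμω hunr h3 _msH _bsH _msQ _bsQ νHv νQv _ _ _ _ mHv mQv hmH hmQ π₁ πSt hlab hπ₁ _ _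
    _ _ _ _ _ _ _ _ _ _ _ _ _ ι₁ ι₂ hι ρ₀ hχ hadm₀ hL2 hbox
  -- the letter's Borel quotient σ-algebras at `v` as LOCAL instances (the statement inlines them by `letI`; instance search must not find Mathlib's quotient σ-algebra)
  letI _qH : ∀ a : HLoc L v, MeasurableSpace (HLoc L v ⧸ Subgroup.centralizer ({a} : Set (HLoc L v))) := fun _ => borel _
  haveI _bqH : ∀ a : HLoc L v, BorelSpace (HLoc L v ⧸ Subgroup.centralizer ({a} : Set (HLoc L v))) := fun _ => ⟨rfl⟩
  letI _qQ : ∀ γ : Gqs L v, MeasurableSpace (Gqs L v ⧸ Subgroup.centralizer ({γ} : Set (Gqs L v))) := fun _ => borel _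
  haveI _bqQ : ∀ γ : Gqs L v, BorelSpace (Gqs L v ⧸ Subgroup.centralizer ({γ} : Set (Gqs L v))) := fun _ => ⟨rfl⟩
  -- E: the archimedean frame (= T2's premises)
  obtain ⟨νGi, hνGi, hνGir, νHi, hνHi, hνHir, tGi, tHi, mGi, mHi, hWG, hCt, hWH, hnd, h5⟩ := hE L μ hμu hμω
  -- T2 → the archimedean sign kit with the cuspidal pins (★ `archSignKitCusp_of_archBlockPacketCusp`)
  obtain ⟨𝔞, hcuspG, hnull, fH, hsmH, htr, hcuspH, hop2⟩ :=
    archSignKitCusp_of_archBlockPacketCusp hT2 L μ νGi νHi mHi mGi tHi tGi hWG hCt hWH hnd h5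
  -- A: globalise `ρ₀`
  obtain ⟨μH, hμH, νH, hνH, PH, ρ₂, WfH, acWfH, mdWfH, σfH, hPσfH, hσfH, hρ₂v, hadm₂, hsph₂, hAT⟩ :=
    hA L μ v νHv νQv mHv mQv πSt hv hμu hμω hunr h3 ρ₀ hadm₀ hL2 νGi νHi tGi tHi mGi mHi 𝔞
  -- B: the `H`-side cut
  obtain ⟨J, hJ, dρ, hinjH, hPHmem, hlinkH, hdρ, hexhH⟩ := hB L μ v νHv νQv mHv mQv πSt μH νH PH ρ₂ WfH σfH hPσfH hσfH
  -- C: the `θ`-line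
  obtain ⟨μ₁, hμ₁, θ, χθ, hχθ, ν₁v, χv, ν₁i, χi, ν₁, hν₁, d₁, hθ, hθχ, hχθv, hχθK, hχvθ, hχv, hlink₁, hd₁, hθi, hcont, hfin⟩ :=
    hC L μ v νHv νQv mHv mQv πSt ξ hv hμu hμω hunr h3
  have key : ∀ (χ₁ χ₂ : H1Loc L v →* ℂˣ) (h₁ : IsOpen ((χ₁.ker : Subgroup (H1Loc L v)) : Set (H1Loc L v)))
      (h₂ : IsOpen ((χ₂.ker : Subgroup (H1Loc L v)) : Set (H1Loc L v))), χ₁ = χ₂ →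
      IrrClass.boxChar χ₁ h₁ (ρ₂ v) = IrrClass.boxChar χ₂ h₂ (ρ₂ v) := by
    rintro χ₁ _ h₁ h₂ rfl; rfl
  have hπSt : πSt = IrrClass.boxChar (χθ v) (hχθ v) (ρ₂ v) := by
    rw [← hbox, ← hρ₂v]; exact key _ _ _ _ hχθv.symm
  -- D: Flath on `H` at the standard levels
  haveI hKHo : Fact (∀ w : Pl L, IsOpen ((((cmLocalIntegralLevel L 2 (Matrix.of fun i j : Fin 2 => if i.val + j.val + 1 = 2 then (1 : L) else 0) w).prod (cmLocalIntegralLevel L 1 (Matrix.of fun i j : Fin 1 => if i.val + j.val + 1 = 1 then (1 : L) else 0) w)) : Subgroup (HLoc L w)) : Set (HLoc L w))) :=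
    ⟨fun w => (UnitaryGroup.isCompact_isOpen_prod_cmLocalIntegralLevel L (Matrix.of fun i j : Fin 2 => if i.val + j.val + 1 = 2 then (1 : L) else 0) (Matrix.of fun i j : Fin 1 => if i.val + j.val + 1 = 1 then (1 : L) else 0) w).2⟩
  obtain ⟨V, acV, mdV, ρ, x₀, W, acW, mdW, σH, hx₀, j, hσH, hline, hadm, hfac₂, hfac₁, hpin⟩ :=
    hD L μ v νHv νQv mHv mQv πSt ρ₂ hadm₂ hsph₂ χθ hχθ hχθK θ hθχ hπSt
  -- the Tate-normalised finite-adelic Haar on `H` (★ `exists_sliceNormalised_haar`)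
  letI msFH : MeasurableSpace (Πʳ w : Pl L, [HLoc L w, ((cmLocalIntegralLevel L 2 (Matrix.of fun i j : Fin 2 => if i.val + j.val + 1 = 2 then (1 : L) else 0) w).prod (cmLocalIntegralLevel L 1 (Matrix.of fun i j : Fin 1 => if i.val + j.val + 1 = 1 then (1 : L) else 0) w))]) := borel _
  haveI bsFH : BorelSpace (Πʳ w : Pl L, [HLoc L w, ((cmLocalIntegralLevel L 2 (Matrix.of fun i j : Fin 2 => if i.val + j.val + 1 = 2 then (1 : L) else 0) w).prod (cmLocalIntegralLevel L 1 (Matrix.of fun i j : Fin 1 => if i.val + j.val + 1 = 1 then (1 : L) else 0) w))]) := ⟨rfl⟩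
  obtain ⟨νfH, hνfHl, hνfHc, hνfH⟩ := exists_sliceNormalised_haar (fun w : Pl L => (((cmLocalIntegralLevel L 2 (Matrix.of fun i j : Fin 2 => if i.val + j.val + 1 = 2 then (1 : L) else 0) w).prod (cmLocalIntegralLevel L 1 (Matrix.of fun i j : Fin 1 => if i.val + j.val + 1 = 1 then (1 : L) else 0) w)) : Subgroup (HLoc L w)))
    (fun w => (UnitaryGroup.isCompact_isOpen_prod_cmLocalIntegralLevel L (Matrix.of fun i j : Fin 2 => if i.val + j.val + 1 = 2 then (1 : L) else 0) (Matrix.of fun i j : Fin 1 => if i.val + j.val + 1 = 1 then (1 : L) else 0) w).1) v νHv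
  -- F: the link law
  have hpacki := hF L μ v νHv νQv mHv mQv πSt ξ hv hμu hμω hunr h3 νGi νHi tGi tHi mGi mHi 𝔞 μH νH PH ρ₂ WfH σfH hPσfH hσfH hAT
    J dρ hinjH hPHmem hlinkH hdρ hexhH μ₁ θ χθ hχθ ν₁v χv ν₁i χi ν₁ d₁ hθ hθχ hχθK hχvθ hχv hlink₁ hd₁ hθi
    V ρ x₀ W σH hx₀ j hσH hline hadm hfac₂ hfac₁ hpin νfH hνfH
  refine ⟨
    { hmHv := hmH, hmQv := hmQ, μH := μH, hμH := hμH, νH := νH, hνH := hνH, PH := PH, ρ₂ := ρ₂, WfH := WfH, acWfH := acWfH,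
      mdWfH := mdWfH, σfH := σfH, hPσfH := hPσfH, hσfH := hσfH, J := J, hJ := hJ, dρ := dρ, hinjH := hinjH, hPHmem := hPHmem,
      hlinkH := hlinkH, hdρ := hdρ, hexhH := hexhH, μ₁ := μ₁, hμ₁ := hμ₁, θ := θ, hθ := hθ, ν₁v := ν₁v, χv := χv, hχv := hχv,
      KH := fun w => ((cmLocalIntegralLevel L 2 (Matrix.of fun i j : Fin 2 => if i.val + j.val + 1 = 2 then (1 : L) else 0) w).prod (cmLocalIntegralLevel L 1 (Matrix.of fun i j : Fin 1 => if i.val + j.val + 1 = 1 then (1 : L) else 0) w)), hKHo := hKHo,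
      hKHc := fun w => (UnitaryGroup.isCompact_isOpen_prod_cmLocalIntegralLevel L (Matrix.of fun i j : Fin 2 => if i.val + j.val + 1 = 2 then (1 : L) else 0) (Matrix.of fun i j : Fin 1 => if i.val + j.val + 1 = 1 then (1 : L) else 0) w).1,
      K₂ := fun w => (cmLocalIntegralLevel L 2 (Matrix.of fun i j : Fin 2 => if i.val + j.val + 1 = 2 then (1 : L) else 0) w), K₁ := fun w => (cmLocalIntegralLevel L 1 (Matrix.of fun i j : Fin 1 => if i.val + j.val + 1 = 1 then (1 : L) else 0) w), hKH := fun w => rfl, hK₂std := fun w _ => rfl, hK₁std := fun w _ => rfl,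
      msFH := msFH, bsFH := bsFH, νfH := νfH, hνfHl := hνfHl, hνfHc := hνfHc, hνfH := hνfH,
      V := V, acV := acV, mdV := mdV, ρ := ρ, x₀ := x₀, W := W, acW := acW, mdW := mdW, σH := σH, hx₀ := hx₀, j := j, S₀ := {v},
      hσH := hσH, hS₀ := Finset.Subset.refl _, hline := hline, hadm := hadm, hfac₂ := hfac₂, hfac₁ := hfac₁, hpin := hpin,
      νGi := νGi, hνGi := hνGi, hνGir := hνGir, νHi := νHi, hνHi := hνHi, hνHir := hνHir, tGi := tGi, tHi := tHi, mGi := mGi, mHi := mHi,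
      hWG := hWG, hWH := hWH, EH := 𝔞.EH, nacgEH := 𝔞.instNACGH, ipsEH := 𝔞.instIPSH, csEH := 𝔞.instCSH, ρi := 𝔞.ρH, hui := 𝔞.huH,
      hsci := 𝔞.hscH, ν₁i := ν₁i, χi := χi, ν₁ := ν₁, hν₁ := hν₁, d₁ := d₁, hlink₁ := hlink₁, hd₁ := hd₁, hθi := hθi,
      harch := ⟨𝔞.frozenG, fH, 𝔞.archSmooth_frozenG, hsmH, htr, hnull, hop2, 𝔞.isArchSignTest_frozenG⟩,
      hpacki := hpacki, h3 := h3, ι₁ := ι₁, ι₂ := ι₂, hι := hι,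
      harch₂ := ⟨𝔞.frozenG, fH, 𝔞.archSmooth_frozenG, hsmH, htr, hnull, hop2, 𝔞.isArchSignTest_frozenG,
        hcuspG ι₁, hcuspG ι₂, hcuspH ι₁, hcuspH ι₂⟩ },
    hρ₂v, rfl, rfl, hcont, hfin⟩

end Summit.HodgeConjecture.HodgeConjecture.R90.S10

end
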